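import Summits.BirchSwinnertonDyer.BirchSwinnertonDyer.Theorems.ClassRecordThreeEulerHalvesAtThreeCartanTorusCubeCutPSUnipotent
import HarnessLib

/-!
# Crux 23422 line `cartan` v9, stub (F2a), PRINCIPAL-SERIES half of the torus-cube cut — file PS-6 (helper): the BOREL FACTORISATIONS
# `G = T_C · B` and `B = Z · D · U` in `GL₂(𝔽_q)`

Seat `bsd-stepL-cartan-f2a` g0 (explicit unit, pen g44 AUTOFILL #2 row (3′); `--supports stmt-BirchSwinnertonDyer-23422 --as helper`).
Two elementary factorisations used to propagate "acts trivially on the quotient line `X̄/K`" from the generators to all of `GL₂(𝔽_q)`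
(the hypothesis `htriv`/`hline` of the reductions `ps*_of_line`, files PS-3/3b/3c; assembly by the line owner tam3-p1):
* `exists_torus_mul_upper` : for every `g` there is `t` in the NON-SPLIT TORUS `T_C = {a·1 + s·η}` with `t⁻¹ g` upper-triangular
  (`T_C` is transitive on `P¹(𝔽_q)`: `t·e₀ = g·e₀` is solvable since `η₁₀ ≠ 0`);
* `upper_eq_scalar_mul_diagGL_mul_unipotent` : an upper-triangular `g = (α β; 0 γ)` is `γ·1 · diag(α/γ, 1) · u(β/α)` with `u` the
  abstract unipotent parametrisation of file PS-4 (`hu : u y = (1 y; 0 1)`).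
HONEST FRAMING: matrix bookkeeping; S-K1′ is NOT proved, no summit statement, no route item and no registered stub is proved; BSD is
proved for no curve. [folklore]
-/

namespace Summit.BirchSwinnertonDyer.BirchSwinnertonDyer.Theorems.CartanTorusCubeCut.PS

open Summit.BirchSwinnertonDyer.BirchSwinnertonDyer.Theorems.CartanDegree
open Summit.BirchSwinnertonDyer.BirchSwinnertonDyer.Theorems.CartanTorusCubeCut

set_option linter.dupNamespace false
set_option autoImplicit false

section Borel
variable {q : ℕ} [Fact q.Prime]

/-- the `(1,0)` entry of a product `t⁻¹ g` vanishes when `g` and `t` have the same first column. -/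
theorem inv_mul_entry10_eq_zero {t g : G q} (h00 : (g : Mat q) 0 0 = (t : Mat q) 0 0) (h10 : (g : Mat q) 1 0 = (t : Mat q) 1 0) :
    ((t⁻¹ * g : G q) : Mat q) 1 0 = 0 := by
  have key : ((t⁻¹ * t : G q) : Mat q) 1 0 = 0 := by rw [inv_mul_cancel, Units.val_one, Matrix.one_apply_ne (by decide)]
  rw [Units.val_mul, Matrix.mul_apply, Fin.sum_univ_two] at key ⊢
  rw [h00, h10]
  exact key

/-- **`G = T_C · B`**: for every `g ∈ GL₂(𝔽_q)` some `t` in the non-split torus of `η` makes `t⁻¹ g` upper-triangular. -/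
theorem exists_torus_mul_upper {η : Mat q} (hη : ¬ HasRatEigenvalue η) (g : G q) :
    ∃ t ∈ nonsplitTorus η, ((t⁻¹ * g : G q) : Mat q) 1 0 = 0 := by
  by_cases hg : (g : Mat q) 1 0 = 0
  · refine ⟨1, by simp [nonsplitTorus], ?_⟩
    rw [inv_one, one_mul]; exact hg
  · have h10 : η 1 0 ≠ 0 := by
      intro h
      apply hη
      refine ⟨η 0 0, ?_⟩
      rw [Matrix.det_fin_two, Matrix.trace_fin_two, h]
      ring
    set s : ZMod q := (g : Mat q) 1 0 * (η 1 0)⁻¹ with hs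
    set a : ZMod q := (g : Mat q) 0 0 - s * η 0 0 with ha
    have hs0 : s ≠ 0 := mul_ne_zero hg (inv_ne_zero h10)
    have hp : ((a, s) : ZMod q × ZMod q) ≠ 0 := fun h => hs0 (congrArg Prod.snd h)
    refine ⟨linGL η hη (a, s), ?_, ?_⟩
    · simp only [nonsplitTorus, Finset.mem_filter, Finset.mem_univ, true_and]
      rw [linGL_coe hη hp]
      exact lin_comm η (a, s)
    · apply inv_mul_entry10_eq_zero
      · rw [linGL_coe hη hp]
        simp [lin, ha]
      · rw [linGL_coe hη hp]
        simp [lin, Matrix.one_apply_ne (by decide : (1 : Fin 2) ≠ 0), hs, inv_mul_cancel_right₀ h10]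

variable (u : ZMod q → G q) (hu : ∀ y, ((u y : G q) : Mat q) = !![1, y; 0, 1])
include hu

/-- **`B = Z · D · U`**: an upper-triangular `g = (α β; 0 γ)` equals `γ·1 · diag(α/γ, 1) · u(β/α)`. -/
theorem upper_eq_scalar_mul_diagGL_mul_unipotent (g : G q) (hg : (g : Mat q) 1 0 = 0) :
    ∃ (c x : (ZMod q)ˣ) (y : ZMod q), g = diagGL ![c, c] * (diagGL ![x, 1] * u y) := by
  have hdet : (g : Mat q).det = (g : Mat q) 0 0 * (g : Mat q) 1 1 := by rw [Matrix.det_fin_two, hg]; ring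
  have hdet0 : (g : Mat q).det ≠ 0 := (Matrix.isUnits_det_units g).ne_zero
  have h00 : (g : Mat q) 0 0 ≠ 0 := fun h => hdet0 (by rw [hdet, h, zero_mul])
  have h11 : (g : Mat q) 1 1 ≠ 0 := fun h => hdet0 (by rw [hdet, h, mul_zero])
  refine ⟨Units.mk0 _ h11, Units.mk0 ((g : Mat q) 0 0 * ((g : Mat q) 1 1)⁻¹) (mul_ne_zero h00 (inv_ne_zero h11)),
    (g : Mat q) 0 1 * ((g : Mat q) 0 0)⁻¹, ?_⟩
  apply Units.ext
  rw [Units.val_mul, diagGL_mul_unipotentParam_coe u hu, diagGL_coe', Matrix.mul_fin_two]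
  ext i j
  fin_cases i <;> fin_cases j
  · simp; field_simp
  · simp; field_simp
  · simp [hg]
  · simp

end Borel

end Summit.BirchSwinnertonDyer.BirchSwinnertonDyer.Theorems.CartanTorusCubeCut.PS
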